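import Literature.MathematicalPhysics.QuantumFieldTheory.Balaban1983to89.B16Absorption

/-!
# `Balaban1983to89.T4Enlargement` — LEMMA Y's ENLARGEMENT INPUT (γ) ON THE CELL'S MODEL
(cell `pub-balaban`, rung (B)+1, node U5; record `t4/T4-EST-U5E-rem.md` v1.4 §4, L5 (γ) and step (2b) (unit
`b2b-balaban-pv25`); consumers BY SHAPE: `…T4SizeLedger.event_size_le` / `foundation_size_le` (binders `hnew`, `hP`);
journal CLAIM T4-U5.E-REM-GAMMA-K* 2026-08-19T03:38:20Z, unit `b2b-balaban-pv25` gen 6 — NEW leaf module, imports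
`…B16Absorption` ONLY (unit b02 gen 10; → `…B16MergeGeometry` → `…B16SProfile`, `…TreeLength`) and modifies nothing;
`…T4SizeLedger` / `…T4BankAgeYoung` / `…T4EpochSize` (this lineage, p182963 / p182815 / p183023) are its consumers BY
SHAPE and are deliberately not imported)

HONEST FRAMING (cell `pub-balaban`, T4-DAG PAGE 1).  The cell's T4 target is the existence AND uniqueness of the
continuum limit of Bałaban's unit-scale averaged loop expectations on a finite torus — strictly beyond ultraviolet
stability ([Balaban1989LargeFieldII] Thm 1 p. 355); it is NOT the Yang–Mills mass gap and NOT the Clay problem.  This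
module is FINITE COMBINATORICS + REAL ARITHMETIC over kernel theorems of the sibling modules ONLY.  The MODEL: the index
lattice `ℤᵈ` of the cubes of the current partition (`B13ScaleTransfer.Pt`), one sup-metric layer of cubes
`B13ScaleTransfer.collar`, `n` layers `collar^[n]` (the reading of print's `X^{~n}` already fixed by b02's
`B16SProfile.Sop := collar^[10] ∘ closureIdx q` for `S(Z) = Z′^{~10}`), the linear size `TreeLength.treeLen`, the boxes
`B16SProfile.box`.  NOTHING of [Balaban1989LargeFieldII] is asserted here: the enlargement inequality (γ) of p. 385 —
printed at `j = 1`, `d′₁((Z₁^{(i)})^{~3}) ≤ 7^d(3·2^{d−1}d′₁(Z₁^{(i)}) + 2^d) ≤ 2(14)^d(d′₁(Z₁^{(i)}) + ½)` — is quoted,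
render-read, in the record's L5; the page number is a LOCATION, there is no quotation (no guillemets) and no `[cite:]`
tag in this file.

WHAT THIS MODULE ADDS (all kernel-checked, `d` arbitrary unless stated).
* §1 CUBE COUNT OF AN ENLARGEMENT: `|X^{~n}| ≤ (2n+1)^d·|X|` (`card_iterate_collar_le`; `X^{~n} = ⋃_{x∈X}{x}^{~n}`,
  `{x}^{~n} ⊆ box x n` = b02's `B16Absorption.iterate_collar_singleton_subset_box`, `|box x n| = (2n+1)^d` =
  `B16SProfile.card_box`) — print's factor `7^d` for `n = 3`.
* §2 (γ) ON THE MODEL: for a non-empty face-connected `X`, `d(X^{~n}) + 1 ≤ (2n+1)^d·2^d·(4·d(X) + 1)`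
  (`treeLen_iterate_collar_add_one_le`: (2.30) upper half `TreeLength.treeLen_le_card_sub_one` on `X^{~n}`, §1, and
  b02's REPAIRED lower half `TreeLength.card_le_treeLen` `|X| ≤ 2^d(4d(X) + 1)` in place of print's `3·2^{d−1}d′ / 2^d`);
  `n = 3`: `d(X^{~3}) + 1 ≤ 14^d·(4·d(X) + 1)` (`treeLen_collar_three_le`; print's (γ) reads `14^d·(2·d′ + 1)` — the
  factor `4` for `2` is the repaired (2.30), cell `GAPS.md` G-B13-07), `n = 2`: `10^d·(…)` (`treeLen_collar_two_le`).
* §3 THE NEW-PART BINDER OF THE SIZE LEDGER, DISCHARGED ON THE MODEL: for a part born at an event,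
  `P = Y^{~2}` or `Y^{~3}` with `Y` non-empty face-connected and `b = d(Y)`, `d(P) + 2 ≤ E·(b + 1)` with the MODEL
  constant `E = 4·14^d` (`hnew_collar_three`, `hnew_collar_two`; record / print: `E = 2·14^d`, and only `log₂E` enters
  the allowance `N′_K(A)`) — literally the binder `hnew : treeLen (P i) + 2 ≤ E * (b i + 1)` of
  `T4SizeLedger.event_size_le` / `foundation_size_le`; and their premise `hP : ∃ T, Admissible (P i) T` for such parts
  (`admissible_iterate_collar`, from `TreeLength.exists_admissible`).  General `n`: `hnew_iterate_collar` with
  `E = 4·(2(2n+1))^d`.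
* §4 NON-VACUITY: the one-cube set (`d(X) = 0`): `d({x}^{~3}) + 1 ≤ 14^d` (`treeLen_collar_three_singleton_le`).

WHAT REMAINS A BINDER / A READING (named, not hidden).  The identification of print's `X^{~n}` with `collar^[n] X` and
of print's `d′_j` with `treeLen` (b02's standing model, `…B16SProfile` / `…TreeLength` headers); that the parts born at an
event ARE of the form `(Z^{(i)}_{j+1})^{~2} ⊆ (…)^{~3}` with `Z^{(i)}_{j+1}` face-connected (record (2b), (1.84) p. 386 —
LOCATION; `treeLen` is not monotone under inclusion, so the model bounds `Y^{~2}` directly rather than through `⊆ Y^{~3}`);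
the printed horizon of p. 385, the counting binders `hD`/`hV`, the S-side bank credits (record §4 (1)).  Cell census:
discharged binder on the MODEL, NOT summit progress; NOT continuum, NOT Clay.
-/

namespace Literature.MathematicalPhysics.QuantumFieldTheory.Balaban1983to89.T4Enlargement

open Literature.MathematicalPhysics.QuantumFieldTheory.Balaban1983to89
open Literature.MathematicalPhysics.QuantumFieldTheory.Balaban1983to89.B13ScaleTransfer
open Literature.MathematicalPhysics.QuantumFieldTheory.Balaban1983to89.TreeLength
open Literature.MathematicalPhysics.QuantumFieldTheory.Balaban1983to89.B16SProfile
open Literature.MathematicalPhysics.QuantumFieldTheory.Balaban1983to89.B16Absorption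

noncomputable section

variable {d : ℕ}

/-! ## §1 The cube count of an enlargement -/

section Count

/-- `n` layers as a union over the cubes: `X^{~n} = ⋃_{x∈X} {x}^{~n}` (`B16SProfile.iterate_collar_biUnion`). [folklore] -/
theorem iterate_collar_eq_biUnion (n : ℕ) (X : Finset (Pt d)) :
    collar^[n] X = X.biUnion fun x => collar^[n] ({x} : Finset (Pt d)) := by
  conv_lhs => rw [← Finset.biUnion_singleton_eq_self (s := X)]
  exact iterate_collar_biUnion n X _

/-- `|{x}^{~n}| ≤ (2n+1)^d` (b02's `iterate_collar_singleton_subset_box` + `card_box`). [folklore] -/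
theorem card_iterate_collar_singleton_le (x : Pt d) (n : ℕ) :
    (collar^[n] ({x} : Finset (Pt d))).card ≤ (2 * n + 1) ^ d :=
  (Finset.card_le_card (iterate_collar_singleton_subset_box x n)).trans (by rw [card_box])

/-- **CUBE COUNT OF AN ENLARGEMENT**: `|X^{~n}| ≤ (2n+1)^d·|X|` — for `n = 3` print's factor `7^d` (p. 385, LOCATION).
[folklore] -/
theorem card_iterate_collar_le (n : ℕ) (X : Finset (Pt d)) :
    (collar^[n] X).card ≤ (2 * n + 1) ^ d * X.card := by
  rw [iterate_collar_eq_biUnion n X]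
  refine Finset.card_biUnion_le.trans ?_
  calc ∑ x ∈ X, (collar^[n] ({x} : Finset (Pt d))).card ≤ ∑ _x ∈ X, (2 * n + 1) ^ d :=
        Finset.sum_le_sum fun x _ => card_iterate_collar_singleton_le x n
    _ = (2 * n + 1) ^ d * X.card := by rw [Finset.sum_const, smul_eq_mul, mul_comm]

/-- An enlargement of a non-empty set is non-empty. [folklore] -/
theorem iterate_collar_nonempty (n : ℕ) {X : Finset (Pt d)} (hX : X.Nonempty) : (collar^[n] X).Nonempty :=
  hX.mono (subset_iterate_collar n X)

/-- An enlargement of a non-empty face-connected set has an admissible graph — the premise `hP` of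
`T4SizeLedger.event_size_le` / `treeLen_fam_add_two_le_sum` for born parts (`TreeLength.exists_admissible` on `X^{~n}`,
face-connected by `B16SProfile.faceConnected_iterate_collar`). [folklore] -/
theorem admissible_iterate_collar (n : ℕ) {X : Finset (Pt d)} (hX : X.Nonempty) (hXc : FaceConnected X) :
    ∃ T, Admissible (collar^[n] X) T := by
  obtain ⟨T, hT, -⟩ := exists_admissible (iterate_collar_nonempty n hX) (faceConnected_iterate_collar n hXc)
  exact ⟨T, hT⟩

end Count

/-! ## §2 The enlargement inequality (γ) on the model -/

section Gamma

/-- **(γ) ON THE MODEL, `n` layers**: `d(X^{~n}) + 1 ≤ (2n+1)^d·2^d·(4·d(X) + 1)` for a non-empty face-connected `X`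
— (2.30) upper half on `X^{~n}` (`d ≤ |·| − 1`), §1, and b02's REPAIRED lower half `|X| ≤ 2^d(4d(X) + 1)`. [folklore] -/
theorem treeLen_iterate_collar_add_one_le (n : ℕ) {X : Finset (Pt d)} (hX : X.Nonempty) (hXc : FaceConnected X) :
    treeLen (collar^[n] X) + 1 ≤ (2 * n + 1) ^ d * (2 ^ d * (4 * treeLen X + 1)) := by
  have h1 := treeLen_le_card_sub_one (iterate_collar_nonempty n hX) (faceConnected_iterate_collar n hXc)
  have h2 : ((collar^[n] X).card : ℝ) ≤ (2 * n + 1) ^ d * (X.card : ℝ) := by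
    exact_mod_cast card_iterate_collar_le n X
  have h3 := card_le_treeLen hX hXc
  have hp : (0 : ℝ) ≤ (2 * n + 1) ^ d := by positivity
  nlinarith [mul_le_mul_of_nonneg_left h3 hp]

/-- **(γ) ON THE MODEL, three layers**: `d(X^{~3}) + 1 ≤ 14^d·(4·d(X) + 1)` (print, p. 385 — LOCATION — has
`14^d·(2d′ + 1)`; the `4` is the repaired (2.30), cell `GAPS.md` G-B13-07). [folklore] -/
theorem treeLen_collar_three_le {X : Finset (Pt d)} (hX : X.Nonempty) (hXc : FaceConnected X) :
    treeLen (collar^[3] X) + 1 ≤ 14 ^ d * (4 * treeLen X + 1) := by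
  have h := treeLen_iterate_collar_add_one_le 3 hX hXc
  have e : ((2 : ℝ) * (3 : ℕ) + 1) ^ d * 2 ^ d = 14 ^ d := by
    rw [← mul_pow]; norm_num
  rw [← mul_assoc, e] at h
  exact h

/-- **(γ) ON THE MODEL, two layers** (the born parts `(Z^{(i)})^{~2}` themselves): `d(X^{~2}) + 1 ≤ 10^d·(4·d(X) + 1)`.
[folklore] -/
theorem treeLen_collar_two_le {X : Finset (Pt d)} (hX : X.Nonempty) (hXc : FaceConnected X) :
    treeLen (collar^[2] X) + 1 ≤ 10 ^ d * (4 * treeLen X + 1) := by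
  have h := treeLen_iterate_collar_add_one_le 2 hX hXc
  have e : ((2 : ℝ) * (2 : ℕ) + 1) ^ d * 2 ^ d = 10 ^ d := by
    rw [← mul_pow]; norm_num
  rw [← mul_assoc, e] at h
  exact h

end Gamma

/-! ## §3 The new-part binder of the size ledger, discharged on the model -/

section NewPart

/-- **THE BINDER `hnew` ON THE MODEL, three layers**: `d(Y^{~3}) + 2 ≤ 4·14^d·(d(Y) + 1)` for `Y` non-empty
face-connected — the shape `treeLen P + 2 ≤ E * (b + 1)` of `T4SizeLedger.event_size_le` / `foundation_size_le` with
`P = Y^{~3}`, `b = d(Y)` and the MODEL constant `E = 4·14^d` (`14^d(4b + 1) + 1 ≤ 4·14^d(b + 1)` since `14^d ≥ 1`).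
[folklore] -/
theorem hnew_collar_three {Y : Finset (Pt d)} (hY : Y.Nonempty) (hYc : FaceConnected Y) :
    treeLen (collar^[3] Y) + 2 ≤ 4 * 14 ^ d * (treeLen Y + 1) := by
  have h := treeLen_collar_three_le hY hYc
  have h14 : (1 : ℝ) ≤ 14 ^ d := one_le_pow₀ (by norm_num)
  nlinarith [treeLen_nonneg Y]

/-- **THE BINDER `hnew` ON THE MODEL, two layers**: `d(Y^{~2}) + 2 ≤ 4·14^d·(d(Y) + 1)` (via `10^d ≤ 14^d`; the born
part itself, without passing through `Y^{~2} ⊆ Y^{~3}` — `treeLen` is not monotone under inclusion). [folklore] -/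
theorem hnew_collar_two {Y : Finset (Pt d)} (hY : Y.Nonempty) (hYc : FaceConnected Y) :
    treeLen (collar^[2] Y) + 2 ≤ 4 * 14 ^ d * (treeLen Y + 1) := by
  have h := treeLen_collar_two_le hY hYc
  have h10 : (10 : ℝ) ^ d ≤ 14 ^ d := pow_le_pow_left₀ (by norm_num) (by norm_num) d
  have h14 : (1 : ℝ) ≤ 14 ^ d := one_le_pow₀ (by norm_num)
  have h0 : 0 ≤ treeLen Y := treeLen_nonneg Y
  have h4 : (0 : ℝ) ≤ 4 * treeLen Y + 1 := by linarith
  nlinarith [mul_le_mul_of_nonneg_right h10 h4]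

/-- **THE BINDER `hnew` ON THE MODEL, `n` layers**: `d(Y^{~n}) + 2 ≤ 4·(2(2n+1))^d·(d(Y) + 1)`. [folklore] -/
theorem hnew_iterate_collar (n : ℕ) {Y : Finset (Pt d)} (hY : Y.Nonempty) (hYc : FaceConnected Y) :
    treeLen (collar^[n] Y) + 2 ≤ 4 * (2 * (2 * n + 1)) ^ d * (treeLen Y + 1) := by
  have h := treeLen_iterate_collar_add_one_le n hY hYc
  have e : ((2 : ℝ) * (2 * n + 1)) ^ d = 2 ^ d * (2 * n + 1) ^ d := by rw [mul_pow]
  have hE : (1 : ℝ) ≤ (2 * (2 * n + 1)) ^ d := one_le_pow₀ (by norm_cast; omega)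
  have h0 : 0 ≤ treeLen Y := treeLen_nonneg Y
  rw [e] at hE ⊢
  nlinarith

/-- THE FAMILY FORM: for a family of born parts `P i = (Y i)^{~3}` (`i ∈ N`, each `Y i` non-empty face-connected) the
two premises of `T4SizeLedger.foundation_size_le` about the parts hold on the model — `hP` (admissible graphs) and
`hnew` with `E = 4·14^d`, `b i = d(Y i)`. [folklore] -/
theorem newParts_binders {ι : Type*} (Y : ι → Finset (Pt d)) (N : Finset ι) (hY : ∀ i ∈ N, (Y i).Nonempty)
    (hYc : ∀ i ∈ N, FaceConnected (Y i)) :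
    (∀ i ∈ N, ∃ T, Admissible (collar^[3] (Y i)) T) ∧
      ∀ i ∈ N, treeLen (collar^[3] (Y i)) + 2 ≤ 4 * 14 ^ d * (treeLen (Y i) + 1) :=
  ⟨fun i hi => admissible_iterate_collar 3 (hY i hi) (hYc i hi), fun i hi => hnew_collar_three (hY i hi) (hYc i hi)⟩

end NewPart

/-! ## §4 Non-vacuity -/

section NonVacuity

/-- The one-cube set: `d({x}^{~3}) + 1 ≤ 14^d` (`d({x}) = 0`). [folklore] -/
theorem treeLen_collar_three_singleton_le (x : Pt d) :
    treeLen (collar^[3] ({x} : Finset (Pt d))) + 1 ≤ 14 ^ d := by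
  have hc : FaceConnected ({x} : Finset (Pt d)) := by
    intro a ha b hb
    rw [Finset.mem_singleton] at ha hb
    subst ha; subst hb
    exact Relation.ReflTransGen.refl
  have h := treeLen_collar_three_le (Finset.singleton_nonempty x) hc
  rw [treeLen_singleton] at h
  linarith

example (x : Pt 4) : treeLen (collar^[3] ({x} : Finset (Pt 4))) + 2 ≤ 4 * 14 ^ 4 * (0 + 1) := by
  have hc : FaceConnected ({x} : Finset (Pt 4)) := by
    intro a ha b hb
    rw [Finset.mem_singleton] at ha hb
    subst ha; subst hb
    exact Relation.ReflTransGen.refl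
  have h := hnew_collar_three (Finset.singleton_nonempty x) hc
  rwa [treeLen_singleton] at h

end NonVacuity

end

end Literature.MathematicalPhysics.QuantumFieldTheory.Balaban1983to89.T4Enlargement
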